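import Mathlib

/-!
# STUB-IDEAS k2 · g33 — «LEVEL-UNIFORM ON THE PAGE» (R200′(b)) + «SEMI-LOCAL = (CO)INDUCTION» (R192′)

Typed sketch for the idea card `Ideas/stub_heegnerIndexLowerAtTwo-k2.md` (gate slug `…-k2-g33`),
crux `stmt-BirchSwinnertonDyer-27851` = `PrintCf2.SplitBadTwoLowerHalfOfFacts`,
stub `stub_heegnerIndexLowerAtTwo` (LEAD skeleton sha16 `f2bd84c029a8a938`).
TECHNIQUE FAMILY 1 — literature transfer (recent-theorem / open-question harvest; typed dictionary).

Mathlib only, no BSD object, no `sorry`.  BSD is NOT proved by any of this; the stub is NOT proved by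
any of this.  What is typed here:

* §A  the valuation bookkeeping behind R200′(b): de Shalit II.4.11 proof (p. 66 l. 7)
      `G(ε) = φ^k(𝔭^n) · χ(𝔮) · τ(χ)` read in valuations, and the p = 2 «no Stickelberger spread»
      lemma `2·v(τ) = n·v(2)` from `τ · c(τ) = 2^n` + `v ∘ c = v` (unique prime above 2 in `ℚ(ζ_{2^∞})`);
* §B  the LTYZ 2025 ↔ de Shalit 1987 dictionary as a record of located exponents (net at type (1,0));
* §C  R192′ «semi-local induction» = Mathlib's finite-index (co)induction API, instantiated so the
      types are seen to line up (`Rep.indResHomEquiv`, `Rep.indCoindIso`, `groupCohomology.coindIso`);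
* §D  level-uniformity: a law stated for every level `n ≥ 1` specialises to the key levels `n ∈ {2,3}`.
-/

set_option linter.dupNamespace false

namespace Summit.BirchSwinnertonDyer.BirchSwinnertonDyer.Cruxes.SplitBadTwoLowerHalfOfFacts.LevelUniformK2G33

/-! ## §A  Valuation bookkeeping of ONE evaluation (de Shalit II.4.8 (19)–(21), II.4.11 (30) and p. 66 l. 7)

Notation: de Shalit's split prime `𝔭` is the route's `𝔮 ∣ 2` of `K₀ = ℚ(√−7)` (embedding of record `ι_𝔮`);
de Shalit's `𝔮` on p. 66 is an AUXILIARY ideal with `(𝔮, F'_n/K) = (𝔭ⁿ, F'_n/K)`, `N𝔮 ≡ 1 (mod pⁿ)`, so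
`χ(𝔮)` is a root of unity.  The exact law read off p. 66 l. 7 + (19) + (30):
`G(ε) = φ^k(𝔭ⁿ) · χ(𝔮) · τ(χ)`, `τ(χ) = p^{-n} Σ_{γ ∈ Gal(F_n/F)} χ(γ) ς_n^{-κ(γ)}` — valid for EVERY
`n ≥ 1` (Lemma 4.8 has no restriction on `n`), in particular at the key levels `n(key) ∈ {2, 3}`. -/

/-- «No Stickelberger spread at 2».  Abstract form: if a valuation-like map `v` is multiplicative,
invariant under an involution-like map `c` (complex conjugation; at `p = 2` every embedding sees the
same valuation because `ℚ(ζ_{2^n})` has ONE prime above `2`), and `τ · c τ = q ^ n`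
(`|τ(χ)|² = 2^n` for a primitive character of conductor `2^n`), then `2 · v τ = n · v q`. -/
theorem two_mul_ord_gaussSum {R : Type*} [CommMonoid R] (v : R → ℤ)
    (hmul : ∀ a b : R, v (a * b) = v a + v b) (c : R → R) (hc : ∀ a, v (c a) = v a)
    (τ q : R) (n : ℕ) (hτ : τ * c τ = q ^ n) :
    2 * v τ = n * v q := by
  have hpow : ∀ m : ℕ, v (q ^ m) = m * v q := by
    intro m
    induction m with
    | zero =>
        -- v 1 = 0 from multiplicativity
        have h1 : v (1 : R) = v 1 + v 1 := by simpa using hmul 1 1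
        simp only [pow_zero, Nat.cast_zero, zero_mul]
        omega
    | succ m ih =>
        rw [pow_succ, hmul, ih]
        push_cast
        ring
  have := congrArg v hτ
  rw [hmul, hc, hpow] at this
  omega

/-- Page ledger of ONE evaluation `ε = φ^k · χ` against de Shalit's measure, `χ` of exact
`𝔭`-exponent `n ≥ 1`, all valuations `ord₂ ∘ ι_𝔭` written in HALF-units (so `n/2` is an integer `n`).
Fields are the located exponents; the two hypotheses are the PAGE relations. -/
structure EvalLedger where
  /-- infinity type `(k, 0)`; `k = 1` at the BSD point of the twist, `k = 0` at finite order -/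
  k : ℕ
  /-- exact exponent of `𝔭` in the conductor of `χ` (`n(key) ∈ {2,3}` at the keys) -/
  n : ℕ
  hn : 1 ≤ n
  /-- `2 · ord₂ ι_𝔮 τ(χ)` for de Shalit's NORMALISED `τ(χ) = p^{-n} Σ χ(γ) ς_n^{-κ(γ)}` ((19), p. 61) -/
  twoOrdTau : ℤ
  /-- `2 · ord₂ ι_𝔮 G(ε)` ((30) p. 65 / (37) p. 71) -/
  twoOrdG : ℤ
  /-- [dS87 II.4.11 proof, p. 66 l. 7] `G(ε) = φ^k(𝔭ⁿ) · χ(𝔮_aux) · τ(χ)` with `ord₂ ι_𝔮 φ(𝔭_dS) = 1`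
  (`(φ(𝔭_dS)) = 𝔭_dS`, class number one) and `χ(𝔮_aux)` a root of unity: `2·ordG = 2·k·n + 2·ordTau`. -/
  page66 : twoOrdG = 2 * k * n + twoOrdTau
  /-- «no Stickelberger spread at 2» (`two_mul_ord_gaussSum`) applied to the CLASSICAL sum
  `Σ χ(γ) ζ^{-κ(γ)}` (valuation `n/2`) and the prefactor `p^{-n}`: `2·ordTau = n - 2n = -n`. -/
  noSpread : twoOrdTau = -(n : ℤ)

namespace EvalLedger

/-- The G-half is determined: `2·ord G(ε) = (2k - 1)·n`. -/
theorem twoOrdG_eq (L : EvalLedger) : L.twoOrdG = (2 * L.k - 1) * L.n := by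
  have h1 := L.page66; have h2 := L.noSpread
  rw [h2] at h1; rw [h1]; ring

/-- At the BSD point of the twist (type `(1,0)`, `k = 1`): the halves are `(+n/2, −n/2)` and NET ZERO,
and their difference is the located integer `n` (= `ord₂ φ(𝔭)^n`).  This is the level-`m` triple
`(prefactor, G, τ_dS) = (0, +n/2, −n/2)` of the critic's R200′(c), valid verbatim at `n = n(key)`. -/
theorem typeOne_net_zero (L : EvalLedger) (hk : L.k = 1) :
    L.twoOrdG + L.twoOrdTau = 0 ∧ L.twoOrdG - L.twoOrdTau = 2 * L.n := by
  have hG := L.twoOrdG_eq; have hτ := L.noSpread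
  rw [hk] at hG
  constructor <;> [rw [hG, hτ]; rw [hG, hτ]] <;> ring

/-- At finite order (`k = 0`, the p-adic Kronecker limit formula II.5.2 (2)): `G = χ(𝔮)·τ`, both
halves equal `−n/2`; no cancellation is available at type `(0,0)`. -/
theorem typeZero_halves_equal (L : EvalLedger) (hk : L.k = 0) :
    L.twoOrdG = L.twoOrdTau ∧ L.twoOrdG = -(L.n : ℤ) := by
  have hG := L.page66; have hτ := L.noSpread
  rw [hk] at hG
  constructor
  · rw [hG]; ring
  · rw [hG, hτ]; ring

end EvalLedger

/-! ## §B  LTYZ 2025 §7 ↔ de Shalit 1987 II §4–§6 — located exponents of the two normalisations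

LTYZ Thm 7.1 (p. 62): `ρ(μ_𝔤) = (τ(ρ_𝔭,ψ_𝔭)/τ(φ_𝔭,ψ_𝔭)) · (Euler factors) · L^{(𝔤𝔭)}(ρ̄,1)/Ω_E`
(CLASSICAL Gauss sums, valuation `+n/2`; the curve's own `τ(φ_𝔭)` divided out; Lemma 7.3 — stated
for `p ≠ 2` — absorbs `τ(φ_𝔭)` into the p-minimal period).  de Shalit (31)/(36): `G(ε)` (valuation
`kn − n/2`).  (7.4)–(7.5) (p. 64) are CHARACTERISTIC-IDEAL identities in `D⟦Gal(F_∞/F_0)⟧`: unit-ambiguous,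
level-free; Gauss sums enter only when a character is EVALUATED.  II.6.4 (9)–(10) (pp. 84–85): the p-adic
functional equation multiplies by the p-adic UNIT `W^{padic}(ε)` — level-free, net zero. -/

/-- The dictionary row for one key, in half-units of `ord₂`. -/
structure KeyRow where
  /-- `n(key) ∈ {2, 3}`: conductor exponent at `𝔭` of the key's quadratic character `χ_d ∘ N` -/
  nKey : ℕ
  hKey : nKey = 2 ∨ nKey = 3
  /-- instantiation of record `E := A = 49a1` (good ordinary at 2): `τ(φ_{A,𝔭}) = 1` -/
  twoOrdTauPhiA : ℤ
  instOfRecord : twoOrdTauPhiA = 0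
  /-- LTYZ's classical `τ(ρ_𝔭, ψ_𝔭)` at `ρ = φ_A · (χ_d∘N) · (finite order)`: `+n(key)/2`, exact by §A -/
  twoOrdTauLTYZ : ℤ
  ltyz71 : twoOrdTauLTYZ = nKey
  /-- de Shalit's `G(ε)` at the same character (type (1,0)): `+n(key)/2` (`EvalLedger.twoOrdG_eq`, k = 1) -/
  twoOrdGdS : ℤ
  dS37 : twoOrdGdS = nKey
  /-- the p-adic root number `W^{padic}` of II.6.4 (10): a unit -/
  twoOrdWpadic : ℤ
  dS64 : twoOrdWpadic = 0

namespace KeyRow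

/-- VERDICT typed: at the character of record the LTYZ-side and the de Shalit-side interpolation
constants carry THE SAME half `+n(key)/2`; their quotient is a unit (no keyed discrepancy), and the
functional equation adds nothing.  What is «read at the key» is the common half, by the level-uniform
law; what is «level-free» is every RATIO the line can form (measure/measure, ε/ε̌). -/
theorem interpolation_constants_agree (r : KeyRow) :
    r.twoOrdTauLTYZ - r.twoOrdTauPhiA - r.twoOrdGdS + r.twoOrdWpadic = 0 := by
  rw [r.ltyz71, r.instOfRecord, r.dS37, r.dS64]; ring

/-- The only keyed integer that survives on the VALUE side against the MEASURE side is `n(key)` itself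
(= `ord₂ φ_A(𝔭)^{n(key)}`, `EvalLedger.typeOne_net_zero`), i.e. `2` or `3` — a located integer, not a half. -/
theorem surviving_integer (r : KeyRow) : (r.nKey : ℤ) = 2 ∨ (r.nKey : ℤ) = 3 := by
  rcases r.hKey with h | h <;> simp [h]

end KeyRow

/-! ## §C  R192′ — de Shalit II.4.1–4.6 «semi-local» = finite-index (co)induction (Mathlib, by name)

Dictionary: `G = Gal(F_n/K)` (finite), `D ≤ G` the decomposition group of one prime `𝔓₀ | 𝔭`,
`U_{n,𝔓₀}` a `k`-linear `D`-representation (`k = ℤ_p` or `D`), the semi-local units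
`U_n = ∏_{𝔓 | 𝔭} U_{n,𝔓}` [dS87 II.4.1, p. 56] = `Coind_D^G U_{n,𝔓₀} ≅ Ind_D^G U_{n,𝔓₀}` (finitely many
primes); a `G`-equivariant map OUT of `U_n` (a measure `β ↦ μ_β`, a Coleman map) is the same as a
`D`-equivariant map out of ONE local factor (Frobenius reciprocity) — this is II.4.5/4.6 «the semi-local
version of I.2.2 / I.3.2–3.4» [p. 59]; Nekovář 8.5.3.1 [AST 310 p. 226] is the Shapiro form on cochains. -/

section SemiLocal

open CategoryTheory

variable {k G : Type} [CommRing k] [Group G] (D : Subgroup G)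

/-- Frobenius reciprocity for maps OUT of the semi-local module (`Rep.indResHomEquiv`). -/
noncomputable example (Uloc : Rep k D) (M : Rep k G) :
    (Rep.ind D.subtype Uloc ⟶ M) ≃ₗ[k] (Uloc ⟶ Rep.res D.subtype M) :=
  Rep.indResHomEquiv D.subtype Uloc M

/-- Finitely many primes above `𝔭`: product = sum, `Ind_D^G ≅ Coind_D^G` (`Rep.indCoindIso`). -/
noncomputable example [D.FiniteIndex] [DecidableRel (QuotientGroup.rightRel D)] (Uloc : Rep k D) :
    Rep.ind D.subtype Uloc ≅ Rep.coind D.subtype Uloc :=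
  Rep.indCoindIso Uloc

/-- Semi-local Shapiro (Nekovář 8.5.3.1 / Mathlib `groupCohomology.coindIso`):
`Hⁿ(G, Coind_D^G U) ≅ Hⁿ(D, U)`. -/
noncomputable example (Uloc : Rep k D) (i : ℕ) :
    groupCohomology (Rep.coind D.subtype Uloc) i ≅ groupCohomology Uloc i :=
  groupCohomology.coindIso Uloc i

end SemiLocal

/-! ## §D  Level-uniformity: de Shalit's Lemma II.4.8 is stated for every `n ≥ 1` (and `k ≥ 0`) -/

/-- A law proved for every ramified level `n ≥ 1` holds at the key levels `2` and `3`; the only way a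
key-level exception can enter line⁺ is through a hypothesis of line⁺ itself that is stated for `n > 3`
(the card names it: the trace-coherent basis / carrier instantiation R201′), never through (19)–(21). -/
theorem law_at_keys (law : ℕ → Prop) (h : ∀ n, 1 ≤ n → law n) : law 2 ∧ law 3 :=
  ⟨h 2 (by norm_num), h 3 (by norm_num)⟩

/-- Conversely, a law only known for `n > 3` says nothing at the keys: the gap is exactly `{1,2,3}`. -/
theorem key_gap (law : ℕ → Prop) (h : ∀ n, 3 < n → law n) (n : ℕ) (hn : 1 ≤ n) :
    law n ∨ n ∈ ({1, 2, 3} : Finset ℕ) := by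
  by_cases h3 : 3 < n
  · exact Or.inl (h n h3)
  · right
    simp only [Finset.mem_insert, Finset.mem_singleton]
    omega

end Summit.BirchSwinnertonDyer.BirchSwinnertonDyer.Cruxes.SplitBadTwoLowerHalfOfFacts.LevelUniformK2G33
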